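import Literature.NumberTheory.EllipticCurves.Kobayashi2003.SignedSelmerGeneratorChangeProofs
import Literature.NumberTheory.EllipticCurves.IwasawaSelmerTorsionProofs
import HarnessLib

/-!
# The `Γ`-invariants and `Γ`-coinvariants of `Sel^ε(E/K_∞)` do not depend on the cyclotomic
# `ℤ_p`-extension datum `(κ, γ)` (proofs)

`Proofs` file (theorems only; no definition, no named fact) in the cluster `Kobayashi2003`, a companion
of `SignedSelmerGeneratorChangeProofs.lean` (torsion-ness and `μ = 0` of `X^ε(E/K_∞)` are independent
of the pair) and of the unsigned `IwasawaGeneratorChangeProofs.lean`; continued in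
`SignedSelmerPairChangeEulerCharProofs.lean` (the constant term of `char X^ε` up to a unit, B. D. Kim's
Euler-characteristic identity). The tree's statements about Kobayashi's `X^ε(E/K_∞) = Sel^ε(E/K_∞)^∨`
quantify over a cyclotomic datum `κ : Γ_K ↠ ℤ_p` and a topological generator `γ` (`κ γ = 1`), and the
`Λ`-structure is `T = conj_γ − 1` (Greenberg, LNM 1716, §1 p. 60: a CHOICE of topological generator).
The `Γ`-Euler characteristic only sees `#Sel^ε_∞^γ = #ker(conj_γ − 1)` and
`#(Sel^ε_∞)_γ = #coker(conj_γ − 1)`; this file proves that these do not depend on the pair: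

* §1 `ZpExtension.exists_eq_ker_mul_pow_mul_of_isUnit` — if `κ γ = v ∈ ℤ_pˣ` (a topological generator,
  `v = 1`, or a topological generator of a unit twist of `κ`) then every `σ ∈ Γ_K` lies in
  `ker κ · γ^k · Nrm` for any open normal subgroup `Nrm` (`p`-adic approximation of `κ(σ)·v⁻¹`; the
  argument of the tree's `conjH1_eq_self_of_isTopGenerator`, which is the case `v = 1`);
* §2 `WeierstrassCurve.exists_conjH1_eq_conjH1_pow_of_isUnit`, `…conjH1_eq_self_of_isUnit`,
  `…conjH1_pow_sub_eq_sum`, `…exists_conjH1_sub_eq_of_isUnit` — on each class `c ∈ H¹(K_∞, E[p^∞])`,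
  `conj_σ c = conj_{γ^k} c` for some `k` (continuity: `exists_openNormalSubgroup_conjH1_eq`; `ker κ`
  acts trivially), so `conj_σ c − c = (conj_γ − 1)(∑_{j<k} conj_{γ^j} c)` (telescoping);
* §3 `endInvariants_conjSignedSelmerInfty_eq_of_isUnit`, `range_conjSignedSelmerInfty_sub_one_eq_of_isUnit`
  — for two unit-valued `γ, γ'` of the same `κ`: `ker(conj_γ − 1) = ker(conj_{γ'} − 1)` and
  `im(conj_γ − 1) = im(conj_{γ'} − 1)` on `Sel^ε(E/K_∞)`;
* §4 `nonempty_endInvariants_equiv_of_isCyclotomic` — for cyclotomic `κ₁, κ₂` the restriction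
  isomorphism `Sel^ε_∞(κ₂) ≃ Sel^ε_∞(κ₁)` (`exists_addEquiv_signedSelmerInfty_of_eq`) commutes with
  `conj_σ` (`resOfLe_comp_conjH1`), so kernels and cokernels of `conj_σ − 1` correspond.
Nothing about any curve's Selmer group is asserted beyond these tautologies of the `Γ`-action.

## References
* [GreenbergLNM1716] R. Greenberg, LNM 1716 (1999), §1 p. 60, §3 Lemma 3.1 (p. 86).
* [Kobayashi2003] S. Kobayashi, Invent. Math. 152 (2003), Def. 1.1 and the sentence following it (p. 2).
* [Washington1997] L. Washington, *Introduction to Cyclotomic Fields*, §13.1.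
-/

noncomputable section

open scoped Classical

universe u

namespace Literature.NumberTheory.EllipticCurves

open Literature.NumberTheory.EllipticCurves.IwasawaDual WeierstrassCurve ZpExtension

/-! ## §1 `σ ∈ ker κ · γ^ℕ · Nrm` for a `γ` whose image topologically generates `Γ` -/

section Decomposition

variable {K : Type u} [Field K] [NumberField K] {p : ℕ} [Fact p.Prime] (κ : ZpExtension K p)

/-- **`Γ_K = ker κ · γ^ℕ · Nrm` for a unit-valued `γ`.** If `κ γ = v` with `v ∈ ℤ_pˣ` then for every
open normal subgroup `Nrm ≤ Γ_K` and every `σ ∈ Γ_K` there are `k ∈ ℕ`, `h ∈ ker κ`, `ν ∈ Nrm` with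
`σ = h · γ^k · ν`: write `[Γ_K : Nrm] = p^a e`, `p ∤ e`; `p`-adic approximation gives `k ∈ ℕ` with
`κ(σ) v⁻¹ ≡ k (mod p^a)`, and `p^a ℤ_p ⊆ κ(Nrm)`. The case `v = 1` is the argument of the tree's
`conjH1_eq_self_of_isTopGenerator` (Greenberg: the image of `γ` is dense in `Γ = Γ_K / ker κ`).
[cite: GreenbergLNM1716, §1 p. 60] -/
theorem ZpExtension.exists_eq_ker_mul_pow_mul_of_isUnit {γ : Field.absoluteGaloisGroup K} {v : ℤ_[p]}
    (hγ : κ γ = Multiplicative.ofAdd v) (hv : IsUnit v)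
    (Nrm : OpenNormalSubgroup (Field.absoluteGaloisGroup K)) (σ : Field.absoluteGaloisGroup K) :
    ∃ (k : ℕ) (h ν : Field.absoluteGaloisGroup K), h ∈ κ.kerSubgroup ∧ ν ∈ Nrm ∧ σ = h * γ ^ k * ν := by
  haveI : Finite (Field.absoluteGaloisGroup K ⧸ Nrm.toSubgroup) :=
    Subgroup.quotient_finite_of_isOpen _ Nrm.isOpen
  have hd : Nrm.toSubgroup.index ≠ 0 := Subgroup.index_ne_zero_of_finite
  obtain ⟨a, e, he, hde⟩ := Nat.exists_eq_pow_mul_and_not_dvd hd p (Fact.out : p.Prime).ne_one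
  obtain ⟨u, hu⟩ := IwasawaDual.isUnit_natCast_padicInt (p := p) he
  obtain ⟨w, hw⟩ := hv
  -- `κ σ · v⁻¹ = k + p^a z` with `k ∈ ℕ`
  set x : ℤ_[p] := (κ σ).toAdd * ((w⁻¹ : ℤ_[p]ˣ) : ℤ_[p]) with hx_def
  obtain ⟨z, hz⟩ := Ideal.mem_span_singleton.mp (PadicInt.appr_spec a x)
  -- `ν = g^{[Γ_K : Nrm]} ∈ Nrm` with `κ ν = p^a z v`
  obtain ⟨g, hg⟩ := κ.surjective (Multiplicative.ofAdd (z * v * ((u⁻¹ : ℤ_[p]ˣ) : ℤ_[p])))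
  have hg' : κ g = Multiplicative.ofAdd (z * v * ((u⁻¹ : ℤ_[p]ˣ) : ℤ_[p])) := hg
  have hνN : g ^ Nrm.toSubgroup.index ∈ Nrm := Nrm.toSubgroup.pow_index_mem g
  have hκν : (κ (g ^ Nrm.toSubgroup.index)).toAdd = (p : ℤ_[p]) ^ a * z * v := by
    rw [map_pow, hg', ← ofAdd_nsmul, toAdd_ofAdd, nsmul_eq_mul, hde, Nat.cast_mul, Nat.cast_pow,
      ← hu]
    calc (p : ℤ_[p]) ^ a * (u : ℤ_[p]) * (z * v * ((u⁻¹ : ℤ_[p]ˣ) : ℤ_[p]))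
        = (p : ℤ_[p]) ^ a * z * v * ((u : ℤ_[p]) * ((u⁻¹ : ℤ_[p]ˣ) : ℤ_[p])) := by ring
      _ = (p : ℤ_[p]) ^ a * z * v := by rw [Units.mul_inv, mul_one]
  have hκγk : (κ (γ ^ PadicInt.appr x a)).toAdd = (PadicInt.appr x a : ℤ_[p]) * v := by
    rw [map_pow, hγ, ← ofAdd_nsmul, toAdd_ofAdd, nsmul_eq_mul]
  have hσ : (κ σ).toAdd = x * v := by
    rw [hx_def, mul_assoc, ← hw, Units.inv_mul, mul_one]
  -- `h = σ ν⁻¹ γ^{-k} ∈ ker κ`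
  have hh : σ * (g ^ Nrm.toSubgroup.index)⁻¹ * (γ ^ PadicInt.appr x a)⁻¹ ∈ κ.kerSubgroup := by
    rw [ZpExtension.mem_kerSubgroup, map_mul, map_mul, map_inv, map_inv]
    apply Multiplicative.toAdd.injective
    rw [toAdd_mul, toAdd_mul, toAdd_inv, toAdd_inv, hκν, hκγk, hσ, toAdd_one]
    linear_combination v * hz
  refine ⟨PadicInt.appr x a, σ * (g ^ Nrm.toSubgroup.index)⁻¹ * (γ ^ PadicInt.appr x a)⁻¹,
    g ^ Nrm.toSubgroup.index, hh, hνN, by group⟩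

end Decomposition

end Literature.NumberTheory.EllipticCurves

/-! ## §2 Conjugation by any `σ` is conjugation by a power of `γ`, on each class -/

namespace WeierstrassCurve

open Literature.NumberTheory.EllipticCurves Literature.NumberTheory.EllipticCurves.IwasawaDual ZpExtension

section Classes

variable {K : Type u} [Field K] [NumberField K] (W : WeierstrassCurve K) {p : ℕ} [Fact p.Prime]
  (κ : ZpExtension K p)

/-- **On each class, `conj_σ` is `conj_{γ^k}` for some `k`** (`κ γ ∈ ℤ_pˣ`): the class `c` is fixed by
an open normal subgroup (`exists_openNormalSubgroup_conjH1_eq`, continuity of the action on the discrete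
module `H¹(K_∞, E[p^∞])`) and by `ker κ` (`conjH1_of_mem`); decompose `σ = h γ^k ν` (§1).
[cite: GreenbergLNM1716, §1 p. 60] -/
theorem exists_conjH1_eq_conjH1_pow_of_isUnit [W.IsElliptic]
    {γ : Field.absoluteGaloisGroup K} {v : ℤ_[p]}
    (hγ : κ γ = Multiplicative.ofAdd v) (hv : IsUnit v) (c : W.subgroupH1 p κ.kerSubgroup)
    (σ : Field.absoluteGaloisGroup K) :
    ∃ k : ℕ, W.conjH1 p κ.kerSubgroup σ c = W.conjH1 p κ.kerSubgroup (γ ^ k) c := by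
  obtain ⟨Nrm, hNrm⟩ := W.exists_openNormalSubgroup_conjH1_eq κ c
  obtain ⟨k, h, ν, hh, hν, rfl⟩ := κ.exists_eq_ker_mul_pow_mul_of_isUnit hγ hv Nrm σ
  refine ⟨k, ?_⟩
  rw [W.conjH1_mul_holds p κ.kerSubgroup _ ν, AddMonoidHom.comp_apply, hNrm _ hν,
    W.conjH1_mul_holds p κ.kerSubgroup h _, AddMonoidHom.comp_apply,
    W.conjH1_of_mem_holds p κ.kerSubgroup hh, AddMonoidHom.id_apply]

/-- **A class fixed by a unit-valued `γ` is fixed by `Γ_K`** — the tree's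
`conjH1_eq_self_of_isTopGenerator` (case `κ γ = 1`) for any `γ` with `κ γ ∈ ℤ_pˣ` (e.g. a topological
generator of a unit twist of `κ`). [cite: GreenbergLNM1716, §1 p. 60 and §3 p. 86] -/
theorem conjH1_eq_self_of_isUnit [W.IsElliptic]
    {γ : Field.absoluteGaloisGroup K} {v : ℤ_[p]}
    (hγ : κ γ = Multiplicative.ofAdd v) (hv : IsUnit v) {c : W.subgroupH1 p κ.kerSubgroup}
    (hc : W.conjH1 p κ.kerSubgroup γ c = c) (σ : Field.absoluteGaloisGroup K) :
    W.conjH1 p κ.kerSubgroup σ c = c := by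
  have hγk : ∀ k : ℕ, W.conjH1 p κ.kerSubgroup (γ ^ k) c = c := fun k ↦ by
    induction k with
    | zero => rw [pow_zero, W.conjH1_one_holds p κ.kerSubgroup, AddMonoidHom.id_apply]
    | succ k ih =>
      rw [pow_succ, W.conjH1_mul_holds p κ.kerSubgroup, AddMonoidHom.comp_apply, hc, ih]
  obtain ⟨k, hk⟩ := W.exists_conjH1_eq_conjH1_pow_of_isUnit κ hγ hv c σ
  rw [hk, hγk]

omit [NumberField K] in
/-- Telescoping: `conj_{γ^k} c − c = (conj_γ − 1)(∑_{j<k} conj_{γ^j} c)` (`conj_{γ^{j+1}} = conj_γ ∘ conj_{γ^j}`,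
`conjH1_mul`). [folklore] -/
private theorem conjH1_pow_sub_eq_sum [W.IsElliptic] (γ : Field.absoluteGaloisGroup K)
    (c : W.subgroupH1 p κ.kerSubgroup) (k : ℕ) :
    W.conjH1 p κ.kerSubgroup (γ ^ k) c - c =
      W.conjH1 p κ.kerSubgroup γ
          (∑ j ∈ Finset.range k, W.conjH1 p κ.kerSubgroup (γ ^ j) c) -
        ∑ j ∈ Finset.range k, W.conjH1 p κ.kerSubgroup (γ ^ j) c := by
  induction k with
  | zero => simp [W.conjH1_one_holds p κ.kerSubgroup]
  | succ k ih =>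
    rw [Finset.sum_range_succ, map_add, ← AddMonoidHom.comp_apply,
      ← W.conjH1_mul_holds p κ.kerSubgroup, ← pow_succ']
    have : W.conjH1 p κ.kerSubgroup (γ ^ (k + 1)) c - c =
        (W.conjH1 p κ.kerSubgroup (γ ^ k) c - c) +
          (W.conjH1 p κ.kerSubgroup (γ ^ (k + 1)) c - W.conjH1 p κ.kerSubgroup (γ ^ k) c) := by abel
    rw [this, ih]
    abel

/-- **`(conj_σ − 1) c ∈ (conj_γ − 1) H¹(K_∞, E[p^∞])` for a unit-valued `γ`**: with `k` from
`exists_conjH1_eq_conjH1_pow_of_isUnit`, `conj_σ c − c = conj_{γ^k} c − c` telescopes.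
[cite: GreenbergLNM1716, §1 p. 60] -/
theorem exists_conjH1_sub_eq_of_isUnit [W.IsElliptic]
    {γ : Field.absoluteGaloisGroup K} {v : ℤ_[p]}
    (hγ : κ γ = Multiplicative.ofAdd v) (hv : IsUnit v) (c : W.subgroupH1 p κ.kerSubgroup)
    (σ : Field.absoluteGaloisGroup K) :
    ∃ k : ℕ, W.conjH1 p κ.kerSubgroup σ c - c =
      W.conjH1 p κ.kerSubgroup γ
          (∑ j ∈ Finset.range k, W.conjH1 p κ.kerSubgroup (γ ^ j) c) -
        ∑ j ∈ Finset.range k, W.conjH1 p κ.kerSubgroup (γ ^ j) c := by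
  obtain ⟨k, hk⟩ := W.exists_conjH1_eq_conjH1_pow_of_isUnit κ hγ hv c σ
  exact ⟨k, by rw [hk, W.conjH1_pow_sub_eq_sum κ γ c k]⟩

end Classes

end WeierstrassCurve

/-! ## §3 The signed Selmer group: `Sel^ε_∞^γ` and `(γ - 1)Sel^ε_∞` do not depend on the unit-valued `γ` -/

namespace Literature.NumberTheory.EllipticCurves.Kobayashi2003

open Literature.NumberTheory.EllipticCurves Literature.NumberTheory.EllipticCurves.IwasawaDual
  WeierstrassCurve ZpExtension

section Signed

variable {K : Type u} [Field K] [NumberField K] (W : WeierstrassCurve K) [W.IsElliptic] {p : ℕ}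
  [Fact p.Prime] (κ : ZpExtension K p) (ε : ℤˣ)

/-- `Sel^ε(E/K_∞)^γ ≤ Sel^ε(E/K_∞)^σ` for a unit-valued `γ` and any `σ` (kernels of `conj − 1` on the
signed Selmer group; `conjH1_eq_self_of_isUnit`). [cite: Kobayashi2003, Def. 1.1 (sentence following it, p. 2)]
[cite: GreenbergLNM1716, §1 p. 60] -/
theorem endInvariants_conjSignedSelmerInfty_le_of_isUnit {γ : Field.absoluteGaloisGroup K} {v : ℤ_[p]}
    (hγ : κ γ = Multiplicative.ofAdd v) (hv : IsUnit v) (σ : Field.absoluteGaloisGroup K) :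
    endInvariants (conjSignedSelmerInfty W κ ε γ - 1) ≤
      endInvariants (conjSignedSelmerInfty W κ ε σ - 1) := by
  intro s hs
  rw [mem_endInvariants_iff, IwasawaDual.End_sub_apply, AddMonoid.End.one_apply, sub_eq_zero] at hs ⊢
  apply Subtype.ext
  rw [coe_conjSignedSelmerInfty_apply]
  have hs' : W.conjH1 p κ.kerSubgroup γ (s : W.subgroupH1 p κ.kerSubgroup) = s := by
    rw [← coe_conjSignedSelmerInfty_apply, hs]
  exact W.conjH1_eq_self_of_isUnit κ hγ hv hs' σ

/-- `(conj_σ − 1) Sel^ε(E/K_∞) ≤ (conj_γ − 1) Sel^ε(E/K_∞)` for a unit-valued `γ` and any `σ`: the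
preimage `∑_{j<k} conj_{γ^j} s` of `exists_conjH1_sub_eq_of_isUnit` lies in the signed Selmer group
(`conjH1_mem_signedSelmerInfty`). [cite: Kobayashi2003, Def. 1.1 (sentence following it, p. 2)]
[cite: GreenbergLNM1716, §1 p. 60] -/
theorem range_conjSignedSelmerInfty_sub_one_le_of_isUnit {γ : Field.absoluteGaloisGroup K}
    {v : ℤ_[p]} (hγ : κ γ = Multiplicative.ofAdd v) (hv : IsUnit v)
    (σ : Field.absoluteGaloisGroup K) :
    AddMonoidHom.range (AddMonoidHomClass.toAddMonoidHom (conjSignedSelmerInfty W κ ε σ - 1)) ≤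
      AddMonoidHom.range (AddMonoidHomClass.toAddMonoidHom (conjSignedSelmerInfty W κ ε γ - 1)) := by
  rintro _ ⟨s, rfl⟩
  obtain ⟨k, hk⟩ := W.exists_conjH1_sub_eq_of_isUnit κ hγ hv (s : W.subgroupH1 p κ.kerSubgroup) σ
  have ht : ∑ j ∈ Finset.range k, W.conjH1 p κ.kerSubgroup (γ ^ j) (s : W.subgroupH1 p κ.kerSubgroup) ∈
      signedSelmerInfty W κ ε :=
    AddSubgroup.sum_mem _ fun j _ ↦ conjH1_mem_signedSelmerInfty W κ ε (γ ^ j) s.2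
  refine ⟨⟨_, ht⟩, ?_⟩
  apply Subtype.ext
  change (((conjSignedSelmerInfty W κ ε γ - 1) ⟨_, ht⟩ : signedSelmerInfty W κ ε) :
      W.subgroupH1 p κ.kerSubgroup) =
    (((conjSignedSelmerInfty W κ ε σ - 1) s : signedSelmerInfty W κ ε) : W.subgroupH1 p κ.kerSubgroup)
  rw [IwasawaDual.End_sub_apply, IwasawaDual.End_sub_apply, AddMonoid.End.one_apply,
    AddMonoid.End.one_apply, AddSubgroupClass.coe_sub, AddSubgroupClass.coe_sub,
    coe_conjSignedSelmerInfty_apply, coe_conjSignedSelmerInfty_apply, hk]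

/-- **`Sel^ε(E/K_∞)^γ = Sel^ε(E/K_∞)^{γ'}`** for two unit-valued elements `γ, γ'` of the same `κ`
(both equal the `Γ_K`-invariants). [cite: GreenbergLNM1716, §1 p. 60] -/
theorem endInvariants_conjSignedSelmerInfty_eq_of_isUnit {γ γ' : Field.absoluteGaloisGroup K}
    {v v' : ℤ_[p]} (hγ : κ γ = Multiplicative.ofAdd v) (hv : IsUnit v)
    (hγ' : κ γ' = Multiplicative.ofAdd v') (hv' : IsUnit v') :
    endInvariants (conjSignedSelmerInfty W κ ε γ - 1) =
      endInvariants (conjSignedSelmerInfty W κ ε γ' - 1) :=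
  le_antisymm (endInvariants_conjSignedSelmerInfty_le_of_isUnit W κ ε hγ hv γ')
    (endInvariants_conjSignedSelmerInfty_le_of_isUnit W κ ε hγ' hv' γ)

/-- **`(conj_γ − 1) Sel^ε(E/K_∞) = (conj_{γ'} − 1) Sel^ε(E/K_∞)`** for two unit-valued `γ, γ'` of the
same `κ` — so the coinvariants `Sel^ε(E/K_∞)_γ` do not depend on the unit-valued `γ`.
[cite: GreenbergLNM1716, §1 p. 60] -/
theorem range_conjSignedSelmerInfty_sub_one_eq_of_isUnit {γ γ' : Field.absoluteGaloisGroup K}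
    {v v' : ℤ_[p]} (hγ : κ γ = Multiplicative.ofAdd v) (hv : IsUnit v)
    (hγ' : κ γ' = Multiplicative.ofAdd v') (hv' : IsUnit v') :
    AddMonoidHom.range (AddMonoidHomClass.toAddMonoidHom (conjSignedSelmerInfty W κ ε γ - 1)) =
      AddMonoidHom.range (AddMonoidHomClass.toAddMonoidHom (conjSignedSelmerInfty W κ ε γ' - 1)) :=
  le_antisymm (range_conjSignedSelmerInfty_sub_one_le_of_isUnit W κ ε hγ' hv' γ)
    (range_conjSignedSelmerInfty_sub_one_le_of_isUnit W κ ε hγ hv γ')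

end Signed

/-! ## §4 Transport along the restriction isomorphism between two cyclotomic data -/

section Transport

variable {S₁ S₂ : Type*} [AddCommGroup S₁] [AddCommGroup S₂]

/-- Kernels of intertwined endomorphisms correspond along an additive isomorphism
(`Ψ ∘ ψ₂ = ψ₁ ∘ Ψ ⇒ ker ψ₂ ≃ ker ψ₁`). [folklore] -/
private theorem nonempty_endInvariants_equiv_of_semiconj (Ψ : S₂ ≃+ S₁) (ψ₂ : AddMonoid.End S₂)
    (ψ₁ : AddMonoid.End S₁) (h : ∀ s, Ψ (ψ₂ s) = ψ₁ (Ψ s)) :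
    Nonempty (endInvariants ψ₂ ≃ endInvariants ψ₁) := by
  refine ⟨Ψ.toEquiv.subtypeEquiv fun s ↦ ?_⟩
  change s ∈ endInvariants ψ₂ ↔ Ψ s ∈ endInvariants ψ₁
  rw [mem_endInvariants_iff, mem_endInvariants_iff, ← h]
  exact (map_eq_zero_iff Ψ Ψ.injective).symm

/-- Cokernels of intertwined endomorphisms correspond along an additive isomorphism
(`Ψ ∘ ψ₂ = ψ₁ ∘ Ψ ⇒ S₂/ψ₂(S₂) ≃ S₁/ψ₁(S₁)`, `QuotientAddGroup.congr`). [folklore] -/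
private theorem nonempty_endCoinvariants_equiv_of_semiconj (Ψ : S₂ ≃+ S₁) (ψ₂ : AddMonoid.End S₂)
    (ψ₁ : AddMonoid.End S₁) (h : ∀ s, Ψ (ψ₂ s) = ψ₁ (Ψ s)) :
    Nonempty (EndCoinvariants ψ₂ ≃+ EndCoinvariants ψ₁) := by
  refine ⟨QuotientAddGroup.congr _ _ Ψ ?_⟩
  ext x
  constructor
  · rintro ⟨_, ⟨s, rfl⟩, rfl⟩
    exact ⟨Ψ s, (h s).symm⟩
  · rintro ⟨y, rfl⟩
    refine ⟨ψ₂ (Ψ.symm y), ⟨Ψ.symm y, rfl⟩, ?_⟩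
    change Ψ (ψ₂ (Ψ.symm y)) = ψ₁ y
    rw [h, AddEquiv.apply_symm_apply]

variable {K : Type u} [Field K] [NumberField K] (W : WeierstrassCurve K) {p : ℕ}
  [Fact p.Prime] (ε : ℤˣ)

/-- **Two cyclotomic data see the same `conj_σ − 1`.** For cyclotomic `κ₁, κ₂` (equal kernels and
layers: `layerSubgroup_eq_of_isCyclotomic`) and any `σ ∈ Γ_K`, the restriction isomorphism
`Sel^ε_∞(κ₂) ≃ Sel^ε_∞(κ₁)` (`exists_addEquiv_signedSelmerInfty_of_eq`) intertwines `conj_σ − 1`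
(`resOfLe_comp_conjH1`), so the kernels `Sel^ε_∞(κᵢ)^σ` are equipotent and so are the cokernels
`Sel^ε_∞(κᵢ)_σ`. [cite: Kobayashi2003, Def. 1.1 (sentence following it, p. 2)] [cite: Washington1997, §13.1] -/
theorem nonempty_endInvariants_equiv_of_isCyclotomic {κ₁ κ₂ : ZpExtension K p}
    (h₁ : κ₁.IsCyclotomic) (h₂ : κ₂.IsCyclotomic) (σ : Field.absoluteGaloisGroup K) :
    Nonempty (endInvariants (conjSignedSelmerInfty W κ₂ ε σ - 1) ≃
      endInvariants (conjSignedSelmerInfty W κ₁ ε σ - 1)) ∧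
    Nonempty (EndCoinvariants (conjSignedSelmerInfty W κ₂ ε σ - 1) ≃+
      EndCoinvariants (conjSignedSelmerInfty W κ₁ ε σ - 1)) := by
  have hK : κ₁.kerSubgroup = κ₂.kerSubgroup := h₁.trans h₂.symm
  obtain ⟨Ψ, hΨ⟩ := exists_addEquiv_signedSelmerInfty_of_eq W hK
    (layerSubgroup_eq_of_isCyclotomic h₁ h₂) ε
  have hsemi : ∀ s, Ψ ((conjSignedSelmerInfty W κ₂ ε σ - 1) s) =
      (conjSignedSelmerInfty W κ₁ ε σ - 1) (Ψ s) := by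
    intro s
    apply Subtype.ext
    rw [hΨ, IwasawaDual.End_sub_apply, IwasawaDual.End_sub_apply, AddMonoid.End.one_apply,
      AddMonoid.End.one_apply, AddSubgroupClass.coe_sub, AddSubgroupClass.coe_sub, map_sub,
      coe_conjSignedSelmerInfty_apply, coe_conjSignedSelmerInfty_apply, hΨ]
    have hc := congrArg (fun f ↦ f (s : W.subgroupH1 p κ₂.kerSubgroup))
      (resOfLe_comp_conjH1_holds (M := W.geomPrimaryTorsion p) hK.le σ)
    congr 1
  exact ⟨nonempty_endInvariants_equiv_of_semiconj Ψ _ _ hsemi,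
    nonempty_endCoinvariants_equiv_of_semiconj Ψ _ _ hsemi⟩

end Transport


end Literature.NumberTheory.EllipticCurves.Kobayashi2003

end
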